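import Literature.AlgebraicGeometry.Morphisms.CechModuleShortExact
import Literature.AlgebraicGeometry.Morphisms.CechModuleFiniteLocallyFreePullback
import Literature.AlgebraicGeometry.Modules.IdealSheafOfClosedImmersion
import Literature.AlgebraicGeometry.Modules.PullbackClosedImmersionUnitIso
import Literature.AlgebraicGeometry.Modules.PullbackQuasicoherent
import Literature.AlgebraicGeometry.Deformation.SquareZeroExtensionObstruction
import Literature.AlgebraicGeometry.Morphisms.ClosedImmersionBaseChangeKer
import Mathlib.AlgebraicGeometry.Morphisms.Affine
import Mathlib.AlgebraicGeometry.IdealSheaf.Subscheme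
import HarnessLib

/-!
# A nilpotent thickening of an affine scheme is affine; an open with affine reduction is affine

Topic `Literature/AlgebraicGeometry/Morphisms`; THEOREMS only (no definition, no named fact, no
instance), in the family `Morphisms/{Iso,Flat,Unramified,BaseChange,Affine}ModuloNilpotent` (the sibling
★ `Morphisms/AffineModuloNilpotent` is the FLAT Artinian case by a cohomology-free topological heart;
this file removes flatness: any nilpotent thickening, by the quasi-coherent dévissage). THE PRINT. The Stacks Project, Tag 06AD (More on Morphisms, Lemma 37.2.3): «Any thickening of an
affine scheme is affine» («The case of a finite order thickening is [GD60, Proposition 5.1.9]» =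
EGA I Prop. 5.1.9; proof of the finite-order case printed there: `H¹(X′, 𝓕) = 0` by dévissage along
`𝓘 = Ker(i♯)` and Serre's criterion). Here, for a closed immersion `i : X₀ ⟶ X` whose kernel ideal
sheaf `i.ker : X.IdealSheafData` (Mathlib) is NILPOTENT (`i.ker ^ n = 0`; no noetherian hypothesis):
* `appTop_surjective_of_isFirstOrderThickening` — for a first-order thickening `j : Y₀ ⟶ Y`
  (`𝓘² = 0`, the tree's `Deformation.IsFirstOrderThickening`) of an AFFINE `Y₀`,
  `j♯ : Γ(Y, 𝒪_Y) → Γ(Y₀, 𝒪_{Y₀})` is surjective (`H¹(Y, 𝓘) = H¹(Y₀, j^*𝓘) = 0`, Tag 01XB);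
* `isAffine_of_isFirstOrderThickening`, `isAffine_of_isNilpotent_ker` — a first-order, resp.
  nilpotent, thickening `X` of an affine scheme `X₀` is affine (Tag 06AD);
* `isAffineOpen_of_isAffineOpen_preimage` — `i.ker` nilpotent, `U ⊆ X` open, `i⁻¹U` affine ⇒ `U`
  affine («an open of `X` whose reduction is affine is affine»);
* `isAffineOpen_of_isPullback_specMap`, `isAffine_of_isPullback_specMap` — base-change form along
  `Spec (R ↠ R₀)` with nilpotent kernel (e.g. an Artinian local ring onto its residue field): an open
  `U ⊆ Q` whose base change `U ×_R R₀ ⊆ Q ×_R R₀` is affine is affine.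
Road (square-zero step, Tag 01XB): `𝓘 ⊆ 𝒪_Y` is a quasi-coherent module killed by `𝓘`, so
`𝓘 ≅ j_* j^* 𝓘` (★ `Modules/PullbackClosedImmersionUnitIso`, Tag 01QY) and its Čech `1`-cocycles on a
covering of `Y` are those of the quasi-coherent `j^* 𝓘` on a covering of the affine `Y₀`, hence
coboundaries (★ `Morphisms/CechModuleAffine`); with ★ `shortExact_idealSheafOf`, `Γ(Y) → Γ(Y₀)` is
onto. Principal opens of `Y₀` inside affine opens of `Y` then lift to global functions of `Y` with
affine basic opens generating the unit ideal (the kernel of `Γ(Y) → Γ(Y₀)` is nil), and Mathlib's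
`isAffine_of_isAffineOpen_basicOpen` (Tag 01QF) concludes. The nilpotent case climbs Mathlib's closed
subschemes `V(𝓘^m) ↪ V(𝓘^(m+1))`; the open / base-change forms use Mathlib's `morphismRestrict` and
★ `Deformation.ker_eq_idealSheafOfIdeal_ker` (`ker = ker ρ · 𝒪_Q`). Cell `hodgecm-mathlib`, F-11
road A (crux `HDel`), brick (R13)/(W3-1) for road (β) of the F3c dictionary. HC_CM is proved only
modulo the 7 printed citations until rung 0 closes — nothing here bears on a summit statement.

## References
* [StacksProject] The Stacks Project, Tag 06AD (Lemma 37.2.3), Tag 01XB (Lemma 30.2.2), Tag 01QF,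
  Tag 01QY, Tag 08KY.
* [EGAI] A. Grothendieck, J. Dieudonné, *Éléments de géométrie algébrique I*, Publ. Math. IHÉS 4
  (1960), Prop. 5.1.9.
* [Hartshorne1977] R. Hartshorne, *Algebraic Geometry*, GTM 52 (1977), II Prop. 5.6 (p. 113),
  III Ex. 3.1.
* [GortzWedhorn2020] U. Görtz, T. Wedhorn, *Algebraic Geometry I*, 2nd ed. (2020), Prop. 4.20.
-/

noncomputable section

-- `TopCat.Presheaf`/`Scheme.Modules` are not reducible (as in Mathlib's `AlgebraicGeometry/Modules`).
set_option backward.isDefEq.respectTransparency false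

open CategoryTheory CategoryTheory.Limits AlgebraicGeometry TopologicalSpace Opposite
open Literature.AlgebraicGeometry.Modules Literature.AlgebraicGeometry.Deformation

universe u

namespace Literature.AlgebraicGeometry.Morphisms

/-! ## §1 Right exactness of sections when `Ȟ¹` of the kernel vanishes on the coverings of `V` -/

/-- **Sections over `V` are right exact when the Čech `1`-cocycles of the kernel on the coverings of
`V` are coboundaries** (the proof of Hartshorne II Prop. 5.6 / Tag 01XB, with the vanishing of
`Ȟ¹(𝒲, M')` as hypothesis in place of «`V` affine, `M'` quasi-coherent»): local lifts of a section
of `M''` differ by a `1`-cocycle of `M'`, a coboundary, and the corrected lifts glue.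
[cite: Hartshorne1977, II Prop. 5.6 (p. 113)] [cite: StacksProject, Tag 01XB] -/
theorem app_surjective_of_shortExact_of_cechMZ1_le {X : Scheme.{u}} {S : ShortComplex X.Modules}
    (hS : S.ShortExact) {V : X.Opens}
    (hH : ∀ ⦃A : Type u⦄ [CommRing A] (f : X ⟶ Spec (.of A)) (W : ↥V → X.Opens), ⨆ p, W p = V →
      cechMZ1 f S.X₁ W ≤ cechMB1 f S.X₁ W) :
    Function.Surjective (S.g.app V) := by
  classical
  haveI := hS.epi_g
  intro s
  obtain ⟨f₀⟩ : Nonempty (X ⟶ Spec Γ(X, ⊤)) := ⟨X.toSpecΓ⟩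
  have hsec := fun U : X.Opens => sections_exact_of_shortExact hS U
  have hinj : ∀ U : X.Opens, Function.Injective (MSections.app f₀ S.f U) := fun U => (hsec U).1
  have hex : ∀ (U : X.Opens) (m : MSections f₀ S.X₂ U), MSections.app f₀ S.g U m = 0 →
      ∃ m' : MSections f₀ S.X₁ U, MSections.app f₀ S.f U m' = m := fun U => (hsec U).2
  -- local lifts `t_p` on a covering `(W_p)_{p ∈ V}` of `V`
  have hloc : ∀ p : V, ∃ (W : X.Opens) (hW : W ≤ V), (p : X) ∈ W ∧
      ∃ t : MSections f₀ S.X₂ W, MSections.app f₀ S.g W t = MSections.res f₀ S.X₃ hW s := fun p =>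
    Literature.AlgebraicGeometry.Motives.Scheme.Modules.exists_app_eq_of_epi S.g V s p p.2
  choose W hWV hpW t ht using hloc
  have hcov : ⨆ p, W p = V := le_antisymm (iSup_le fun p => hWV p)
    fun q hq => Opens.mem_iSup.mpr ⟨⟨q, hq⟩, hpW ⟨q, hq⟩⟩
  -- the differences of the local lifts come from a cocycle `c` of `M'`
  have hdiff : cechMapC1 f₀ S.g W (cechMD0 f₀ S.X₂ W t) = 0 := by
    funext p q
    rw [cechMapC1_apply, cechMD0_apply, map_sub, ← MSections.res_app, ← MSections.res_app, ht, ht,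
      MSections.res_res, MSections.res_res]
    exact sub_self _
  obtain ⟨c, hc⟩ := exists_mapC1_eq_of_mapC1_eq_zero f₀ W S.f S.g hex hdiff
  have hcZ : c ∈ cechMZ1 f₀ S.X₁ W := mem_cechMZ1_of_mapC1_eq_cechMD0 f₀ W S.f hinj hc
  obtain ⟨v, hv⟩ := (mem_cechMB1_iff f₀ S.X₁ W c).mp (hH f₀ W hcov hcZ)
  -- the corrected lifts `t_p - φ v_p` glue
  have hglue : cechMD0 f₀ S.X₂ W (t - cechMapC0 f₀ S.f W v) = 0 := by
    rw [map_sub, cechMD0_mapC0, hv, hc, sub_self]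
  obtain ⟨T, hT⟩ := MSections.exists_res_eq f₀ S.X₂ W hWV hcov.ge (t - cechMapC0 f₀ S.f W v)
    fun p q => (sub_eq_zero.mp (by rw [← cechMD0_apply, hglue]; rfl)).symm
  refine ⟨T, ?_⟩
  apply MSections.eq_of_res_eq f₀ S.X₃ W hWV hcov.ge
  intro p
  change MSections.res f₀ S.X₃ (hWV p) (MSections.app f₀ S.g V T) = _
  rw [MSections.res_app, hT, Pi.sub_apply, map_sub, cechMapC0_apply,
    show MSections.app f₀ S.g (W p) (MSections.app f₀ S.f (W p) (v p)) = 0 from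
      app_app_eq_zero S _ _, sub_zero, ht]

/-! ## §2 Functions lift along a first-order thickening of an affine scheme -/

section FirstOrder

variable {Y₀ Y : Scheme.{u}} (j : Y₀ ⟶ Y)

/-- For a first-order thickening (`𝓘 · 𝓘 = 0`), the ideal sheaf module `𝓘_{Y₀} ⊆ 𝒪_Y` is killed by
the ideal `𝓘 = ker j♯`. [cite: StacksProject, Tag 08KY] -/
theorem isKilledBy_ker_idealSheafOf [IsClosedImmersion j] (h2 : j.ker * j.ker = ⊥) :
    IsKilledBy j.ker (idealSheafOf j) := by
  intro V r hr n
  apply idealSheafOfι_app_injective j V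
  rw [Scheme.Modules.Hom.app_smul, map_zero]
  -- `r · x ∈ 𝓘(V) · 𝓘(V) = (𝓘 · 𝓘)(V) = 0` for `x ∈ 𝓘(V)`
  have key : ∀ x : Γ(Y, ↑V), x ∈ j.ker.ideal V → r * x = 0 := fun x hx => by
    have hmem : r * x ∈ (j.ker * j.ker).ideal V := by
      rw [Scheme.IdealSheafData.ideal_mul, Pi.mul_apply]
      exact Ideal.mul_mem_mul hr hx
    rwa [h2, Scheme.IdealSheafData.ideal_bot, Pi.bot_apply, Ideal.mem_bot] at hmem
  exact key _ (idealSheafOfι_app_mem j V.2 n)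

/-- **`Ȟ¹(𝒲, 𝓘) = 0` for the ideal of a first-order thickening `j : Y₀ ⟶ Y` of an AFFINE `Y₀` and
every family of opens `𝒲` covering `Y`**: `𝓘 ≅ j_* j^* 𝓘` (`𝓘` is quasi-coherent and killed by `𝓘`,
Tag 01QY), and the `1`-cocycles of `j_* j^* 𝓘` on `𝒲` are those of the quasi-coherent `j^* 𝓘` on the
covering `j⁻¹𝒲` of the affine scheme `Y₀`, which are coboundaries (Tag 01XB).
[cite: StacksProject, Tag 01XB] [cite: StacksProject, Tag 01QY] -/
theorem cechMZ1_idealSheafOf_le_cechMB1 [IsClosedImmersion j] (h2 : j.ker * j.ker = ⊥) [IsAffine Y₀]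
    {A : Type u} [CommRing A] (g : Y ⟶ Spec (.of A)) {ι : Type u} (W : ι → Y.Opens)
    (hW : ⨆ i, W i = ⊤) : cechMZ1 g (idealSheafOf j) W ≤ cechMB1 g (idealSheafOf j) W := by
  have hM : IsAffineLocalizing (idealSheafOf j) := isAffineLocalizing_idealSheafOf j
  have hK : IsKilledBy j.ker (idealSheafOf j) := isKilledBy_ker_idealSheafOf j h2
  -- `𝓘 ≅ j_* j^* 𝓘`, `j^* 𝓘` quasi-coherent on the affine `Y₀`
  let e := unitIsoOfIsKilledBy j (idealSheafOf j) hM hK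
  have hP : IsAffineLocalizing ((Scheme.Modules.pullback j).obj (idealSheafOf j)) := hM.pullback j
  have h₀ : cechMZ1 (j ≫ g) ((Scheme.Modules.pullback j).obj (idealSheafOf j)) (fun i => j ⁻¹ᵁ W i) ≤
      cechMB1 (j ≫ g) ((Scheme.Modules.pullback j).obj (idealSheafOf j)) (fun i => j ⁻¹ᵁ W i) :=
    cechMZ1_le_cechMB1_of_isAffineOpen (j ≫ g) hP (isAffineOpen_top Y₀) (fun i => j ⁻¹ᵁ W i)
      (j.iSup_preimage_eq_top hW)
  have h₁ := cechMZ1_pushforward_le_cechMB1_of_le g j _ W h₀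
  intro c hc
  have hb : cechMapC1 g e.hom W c ∈ cechMB1 g _ W := h₁ (mapC1_mem_cechMZ1 g e.hom W hc)
  have hc' := mapC1_mem_cechMB1 g e.inv W hb
  have heq : cechMapC1 g e.inv W (cechMapC1 g e.hom W c) = c := by
    funext i k
    rw [cechMapC1_apply, cechMapC1_apply, ← MSections.app_comp, Iso.hom_inv_id, MSections.app_id]
  rwa [heq] at hc'

/-- **Functions lift along a first-order thickening of an affine scheme**: for a first-order
thickening `j : Y₀ ⟶ Y` (`𝓘² = 0`) with `Y₀` affine, `j♯ : Γ(Y, 𝒪_Y) → Γ(Y₀, 𝒪_{Y₀})` is surjective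
(`0 → 𝓘 → 𝒪_Y → j_*𝒪_{Y₀} → 0` and `H¹(Y, 𝓘) = H¹(Y₀, 𝓘) = 0`).
[cite: StacksProject, Tag 06AD (proof)] [cite: StacksProject, Tag 01XB] -/
theorem appTop_surjective_of_isFirstOrderThickening [IsFirstOrderThickening j] [IsAffine Y₀] :
    Function.Surjective j.appTop := by
  have hsurj : Function.Surjective ((algebraUnit j).app ⊤) :=
    app_surjective_of_shortExact_of_cechMZ1_le (shortExact_idealSheafOf j) fun A _ g W hW =>
      cechMZ1_idealSheafOf_le_cechMB1 j (IsFirstOrderThickening.ker_mul_ker_eq_bot (i := j)) g W hW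
  exact fun s => hsurj s

/-- The kernel of `j♯ : Γ(Y, 𝒪_Y) → Γ(Y₀, 𝒪_{Y₀})` has square zero for a first-order thickening:
a global function vanishing on `Y₀` lies in `𝓘(V)` on every affine open `V`, and `𝓘(V)² = 0`.
[cite: StacksProject, Tag 08KY] -/
theorem mul_self_eq_zero_of_appTop_eq_zero [IsFirstOrderThickening j] (a : Γ(Y, ⊤))
    (ha : j.appTop a = 0) : a * a = 0 := by
  -- check on the affine opens of `Y`
  refine TopCat.Sheaf.eq_of_locally_eq' Y.sheaf (fun V : Y.affineOpens => (V : Y.Opens)) ⊤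
    (fun V => homOfLE le_top) (by rw [iSup_affineOpens_eq_top]) (a * a) 0 fun V => ?_
  rw [map_mul, map_zero]
  have hV : Y.presheaf.map (homOfLE (le_top : (V : Y.Opens) ≤ ⊤)).op a ∈ j.ker.ideal V := by
    rw [Scheme.Hom.ker_apply, RingHom.mem_ker]
    change (Y.presheaf.map (homOfLE le_top).op ≫ j.app V) a = 0
    rw [j.naturality]
    change Y₀.presheaf.map _ (j.appTop a) = 0
    rw [ha, map_zero]
  have hmem : Y.presheaf.map (homOfLE (le_top : (V : Y.Opens) ≤ ⊤)).op a *
      Y.presheaf.map (homOfLE (le_top : (V : Y.Opens) ≤ ⊤)).op a ∈ (j.ker * j.ker).ideal V := by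
    rw [Scheme.IdealSheafData.ideal_mul, Pi.mul_apply]
    exact Ideal.mul_mem_mul hV hV
  rw [IsFirstOrderThickening.ker_mul_ker_eq_bot (i := j), Scheme.IdealSheafData.ideal_bot,
    Pi.bot_apply, Ideal.mem_bot] at hmem
  exact hmem


/-! ## §3 A first-order thickening of an affine scheme is affine -/

/-- **A first-order thickening of an affine scheme is affine** (the square-zero case of Tag 06AD /
EGA I 5.1.9): principal opens `D(f̄) ⊆ j⁻¹V` of the affine `Y₀` subordinate to affine opens `V` of
`Y` lift (`appTop_surjective_of_isFirstOrderThickening`) to global functions `g` of `Y` with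
`Y_g = D_V(g|_V)` affine; their images generate the unit ideal of `Γ(Y₀, 𝒪)`, and a lift of `1`
differs from `1` by a square-zero element, so the `g` generate the unit ideal of `Γ(Y, 𝒪)` and
Mathlib's `isAffine_of_isAffineOpen_basicOpen` (Tag 01QF) applies.
[cite: StacksProject, Tag 06AD] [cite: EGAI, Prop. 5.1.9] -/
theorem isAffine_of_isFirstOrderThickening [IsFirstOrderThickening j] [IsAffine Y₀] : IsAffine Y := by
  have hsurj := appTop_surjective_of_isFirstOrderThickening j
  -- the global functions of `Y` with affine basic open
  let s : Set Γ(Y, ⊤) := {g | IsAffineOpen (Y.basicOpen g)}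
  refine isAffine_of_isAffineOpen_basicOpen s ?_ fun g hg => hg
  -- every point of `Y₀` lies in `D(j♯ g)` for some `g ∈ s`
  have hpt : ∀ x : Y₀, ∃ g ∈ s, x ∈ Y₀.basicOpen (j.appTop g) := by
    intro x
    obtain ⟨V, hV, hxV, -⟩ := Opens.isBasis_iff_nbhd.mp Y.isBasis_affineOpens (Opens.mem_top (j x))
    obtain ⟨f, hfV, hxf⟩ :=
      (isAffineOpen_top Y₀).exists_basicOpen_le (V := j ⁻¹ᵁ V) ⟨x, hxV⟩ (Opens.mem_top x)
    obtain ⟨g, rfl⟩ := hsurj f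
    refine ⟨g, ?_, hxf⟩
    -- `Y_g ≤ V` (compare preimages; `j` is onto), so `Y_g = D_V(g|_V)` is affine
    have hle : Y.basicOpen g ≤ V := fun y hy => by
      obtain ⟨x, rfl⟩ := IsFirstOrderThickening.surjective j y
      exact (show j ⁻¹ᵁ Y.basicOpen g ≤ j ⁻¹ᵁ V by rw [Scheme.preimage_basicOpen_top]; exact hfV) hy
    have heq : Y.basicOpen (Y.presheaf.map (homOfLE (le_top : V ≤ ⊤)).op g) = Y.basicOpen g := by
      rw [Scheme.basicOpen_res, inf_eq_right.mpr hle]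
    change IsAffineOpen (Y.basicOpen g)
    rw [← heq]
    exact hV.basicOpen _
  -- hence the images of `s` generate the unit ideal of `Γ(Y₀, 𝒪)`
  have hspan₀ : Ideal.span (j.appTop.hom '' s) = ⊤ := by
    rw [← (isAffineOpen_top Y₀).iSup_basicOpen_eq_self_iff]
    refine top_le_iff.mp fun x _ => ?_
    obtain ⟨g, hg, hx⟩ := hpt x
    exact Opens.mem_iSup.mpr ⟨⟨j.appTop g, g, hg, rfl⟩, hx⟩
  -- a lift `u ∈ span s` of `1` is `1` plus a square-zero element, hence a unit
  have h1 : (1 : Γ(Y₀, ⊤)) ∈ (Ideal.span s).map j.appTop.hom := by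
    rw [Ideal.map_span, hspan₀]
    trivial
  obtain ⟨u, hu, hu1⟩ := (Ideal.mem_map_iff_of_surjective j.appTop.hom hsurj).mp h1
  have hn : (u - 1) * (u - 1) = 0 :=
    mul_self_eq_zero_of_appTop_eq_zero j (u - 1) (by rw [map_sub, map_one, hu1, sub_self])
  have hunit : IsUnit u := by
    have h : IsNilpotent (u - 1) := ⟨2, by rw [pow_two, hn]⟩
    simpa using h.isUnit_add_one
  exact Ideal.eq_top_of_isUnit_mem _ hu hunit

end FirstOrder

/-! ## §4 Nilpotent thickenings: the tower `V(𝓘) ↪ V(𝓘²) ↪ ⋯ ↪ V(𝓘ⁿ⁺¹) = X` -/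

section Nilpotent

variable {X₀ X : Scheme.{u}}

/-- `𝓘^(m+1) ≤ 𝓘^m` for ideal sheaves. [folklore] -/
private theorem pow_succ_le_pow (I : X.IdealSheafData) (m : ℕ) : I ^ (m + 1) ≤ I ^ m := fun U => by
  rw [Scheme.IdealSheafData.ideal_pow, Scheme.IdealSheafData.ideal_pow, Pi.pow_apply, Pi.pow_apply]
  exact Ideal.pow_le_pow_right m.le_succ

/-- The closed immersion `V(𝓘^m) ↪ V(𝓘^(m+1))` of Mathlib's closed subschemes
(`Scheme.IdealSheafData.inclusion`). [cite: StacksProject, Tag 06AD (proof)] -/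
theorem isClosedImmersion_inclusion_pow (I : X.IdealSheafData) (m : ℕ) :
    IsClosedImmersion (Scheme.IdealSheafData.inclusion (pow_succ_le_pow I m)) := by
  have : IsClosedImmersion
      (Scheme.IdealSheafData.inclusion (pow_succ_le_pow I m) ≫ (I ^ (m + 1)).subschemeι) := by
    rw [Scheme.IdealSheafData.inclusion_subschemeι]
    infer_instance
  exact IsClosedImmersion.of_comp_isClosedImmersion _ (I ^ (m + 1)).subschemeι

/-- **`V(𝓘^m) ↪ V(𝓘^(m+1))` is a first-order thickening for `m ≥ 1`**: on the affine open
`V(𝓘^(m+1)) ∩ U`, `U ⊆ X` affine, its ideal is `𝓘(U)^m / 𝓘(U)^(m+1)`, whose square vanishes as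
`2m ≥ m + 1`. [cite: StacksProject, Tag 06AD (proof)] [cite: EGAI, Prop. 5.1.9] -/
theorem isFirstOrderThickening_inclusion_pow (I : X.IdealSheafData) {m : ℕ} (hm : 1 ≤ m) :
    IsFirstOrderThickening (Scheme.IdealSheafData.inclusion (pow_succ_le_pow I m)) := by
  haveI := isClosedImmersion_inclusion_pow I m
  set k := Scheme.IdealSheafData.inclusion (pow_succ_le_pow I m)
  set ι := (I ^ m).subschemeι
  set ι' := (I ^ (m + 1)).subschemeι
  have hcomp : k ≫ ι' = ι := Scheme.IdealSheafData.inclusion_subschemeι _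
  refine ⟨Scheme.IdealSheafData.ext_of_iSup_eq_top
    (fun U : X.affineOpens => ⟨ι' ⁻¹ᵁ (U : X.Opens), U.2.preimage ι'⟩)
    (ι'.iSup_preimage_eq_top (iSup_affineOpens_eq_top X)) fun U => ?_⟩
  rw [Scheme.IdealSheafData.ideal_mul, Pi.mul_apply, Scheme.IdealSheafData.ideal_bot, Pi.bot_apply,
    Scheme.Hom.ker_apply]
  -- functions on `V(𝓘^(m+1)) ∩ U` come from `Γ(X, U)`; `k♯` kills exactly the classes of `𝓘(U)^m`
  have hsurj : Function.Surjective (ι'.app U) := (I ^ (m + 1)).subschemeι_app_surjective U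
  have hker : ∀ (n : ℕ) (a : Γ(X, U)), (I ^ n).subschemeι.app U a = 0 ↔ a ∈ I.ideal U ^ n :=
    fun n a => by
    rw [← RingHom.mem_ker, show RingHom.ker ((I ^ n).subschemeι.app U).hom = (I ^ n).ideal U from
      (I ^ n).ker_subschemeι_app U, Scheme.IdealSheafData.ideal_pow, Pi.pow_apply]
  have hk : ∀ a : Γ(X, U), k.app (ι' ⁻¹ᵁ U) (ι'.app U a) = 0 ↔ ι.app U a = 0 := fun a => by
    rw [← CommRingCat.comp_apply, ← Scheme.Hom.comp_app, Scheme.Hom.congr_app hcomp U,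
      CommRingCat.comp_apply]
    exact map_eq_zero_iff _ (ConcreteCategory.bijective_of_isIso _).1
  refine le_bot_iff.mp (Ideal.mul_le.mpr fun a ha b hb => ?_)
  obtain ⟨a', rfl⟩ := hsurj a
  obtain ⟨b', rfl⟩ := hsurj b
  rw [RingHom.mem_ker] at ha hb
  have ha' : a' ∈ I.ideal U ^ m := (hker m a').mp ((hk a').mp ha)
  have hb' : b' ∈ I.ideal U ^ m := (hker m b').mp ((hk b').mp hb)
  have hab : a' * b' ∈ I.ideal U ^ (m + 1) := by
    have h := Ideal.mul_mem_mul ha' hb'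
    rw [← pow_add] at h
    exact Ideal.pow_le_pow_right (by omega) h
  change ι'.app U a' * ι'.app U b' ∈ (⊥ : Ideal _)
  rw [Ideal.mem_bot, ← map_mul]
  exact (hker (m + 1) _).mpr hab

/-- The closed subschemes `V(𝓘^m)`, `m ≥ 1`, of a scheme with `V(𝓘)` affine are affine.
[cite: StacksProject, Tag 06AD] [cite: EGAI, Prop. 5.1.9] -/
theorem isAffine_subscheme_pow (I : X.IdealSheafData) (hI : IsAffine I.subscheme) {m : ℕ}
    (hm : 1 ≤ m) : IsAffine (I ^ m).subscheme := by
  induction m, hm using Nat.le_induction with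
  | base => rwa [pow_one]
  | succ m hm ih =>
    haveI := isFirstOrderThickening_inclusion_pow I hm
    haveI : IsAffine (I ^ m).subscheme := ih
    exact isAffine_of_isFirstOrderThickening (Scheme.IdealSheafData.inclusion (pow_succ_le_pow I m))

variable (i : X₀ ⟶ X) [IsClosedImmersion i]

/-- **A nilpotent thickening of an affine scheme is affine** (Tag 06AD; EGA I 5.1.9): for a closed
immersion `i : X₀ ⟶ X` with nilpotent kernel ideal sheaf and `X₀` affine, `X` is affine
(`X₀ ≅ V(𝓘)`, the tower `V(𝓘^m) ↪ V(𝓘^(m+1))` of first-order thickenings, `V(𝓘ⁿ⁺¹) = V(0) = X`).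
[cite: StacksProject, Tag 06AD] [cite: EGAI, Prop. 5.1.9] -/
theorem isAffine_of_isNilpotent_ker (hnil : IsNilpotent i.ker) [IsAffine X₀] : IsAffine X := by
  obtain ⟨n, hn⟩ := hnil
  have hI : IsAffine i.ker.subscheme := IsAffine.of_isIso (inv i.toImage)
  have hn' : i.ker ^ (n + 1) = ⊥ := by
    rw [pow_succ, hn, zero_mul, Scheme.IdealSheafData.zero_eq_bot]
  have h := isAffine_subscheme_pow i.ker hI (Nat.succ_pos n)
  rw [hn'] at h
  exact IsAffine.of_isIso (inv (⊥ : X.IdealSheafData).subschemeι)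

/-- **An open of a nilpotent thickening with affine reduction is affine**: for a closed immersion
`i : X₀ ⟶ X` with nilpotent kernel ideal sheaf and an open `U ⊆ X` with `i⁻¹U` affine, `U` is
affine (`i` restricted over `U` is again a nilpotent thickening). [cite: StacksProject, Tag 06AD]
[cite: EGAI, Prop. 5.1.9] -/
theorem isAffineOpen_of_isAffineOpen_preimage (hnil : IsNilpotent i.ker) {U : X.Opens}
    (hU : IsAffineOpen (i ⁻¹ᵁ U)) : IsAffineOpen U := by
  haveI : IsAffine (i ⁻¹ᵁ U) := hU
  haveI : IsClosedImmersion (i ∣_ U) := IsZariskiLocalAtTarget.restrict ‹_› U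
  have hnil' : IsNilpotent (i ∣_ U).ker := by
    obtain ⟨n, hn⟩ := hnil
    refine ⟨n, Scheme.IdealSheafData.ext (funext fun V => ?_)⟩
    have h := congrArg
      (fun J : X.IdealSheafData => J.ideal ⟨U.ι ''ᵁ V.1, V.2.image_of_isOpenImmersion U.ι⟩) hn
    simp only [Scheme.IdealSheafData.ideal_pow, Pi.pow_apply, Scheme.IdealSheafData.zero_eq_bot,
      Scheme.IdealSheafData.ideal_bot, Pi.bot_apply] at h ⊢
    rw [Scheme.ker_morphismRestrict_ideal]
    exact h
  exact isAffine_of_isNilpotent_ker (i ∣_ U) hnil'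

end Nilpotent

/-! ## §5 Base-change form: opens of `Q` whose base change along `Spec (R ↠ R₀)` is affine -/

section SpecBase

variable {R R₀ : Type u} [CommRing R] [CommRing R₀] (ρ : R →+* R₀) {Q Q₀ : Scheme.{u}}
  {q : Q ⟶ Spec (.of R)} {q₀ : Q₀ ⟶ Spec (.of R₀)} {iQ : Q₀ ⟶ Q}

/-- The kernel ideal sheaf of the base change `iQ : Q ×_R R₀ ⟶ Q` of `Spec (R ↠ R₀)` is nilpotent
when `ker (R ↠ R₀)` is (it is `ker ρ · 𝒪_Q`, ★ `Deformation.ker_eq_idealSheafOfIdeal_ker`).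
[cite: GortzWedhorn2020, Prop. 4.20 (p. 104)] -/
theorem isNilpotent_ker_of_isPullback_specMap (hρ : Function.Surjective ρ)
    (hnil : IsNilpotent (RingHom.ker ρ)) (hQ : IsPullback iQ q₀ q (Spec.map (CommRingCat.ofHom ρ))) :
    IsNilpotent iQ.ker := by
  obtain ⟨n, hn⟩ := hnil
  rw [Deformation.ker_eq_idealSheafOfIdeal_ker ρ hρ hQ]
  refine ⟨n, Scheme.IdealSheafData.ext (funext fun U => ?_)⟩
  rw [Scheme.IdealSheafData.ideal_pow, Pi.pow_apply, Deformation.idealSheafOfIdeal_ideal,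
    ← Ideal.map_pow, hn, Ideal.zero_eq_bot, Ideal.map_bot]
  rfl

/-- **An open whose base change along a nilpotent thickening of the base ring is affine is affine**:
`ρ : R ↠ R₀` surjective with nilpotent kernel (e.g. an Artinian local ring onto its residue field),
`hQ : IsPullback iQ q₀ q (Spec ρ)` (`Q₀ = Q ×_R R₀`), `U ⊆ Q` open with `iQ⁻¹U = U ×_R R₀` affine
⇒ `U` affine. [cite: StacksProject, Tag 06AD] [cite: EGAI, Prop. 5.1.9] -/
theorem isAffineOpen_of_isPullback_specMap (hρ : Function.Surjective ρ)
    (hnil : IsNilpotent (RingHom.ker ρ)) (hQ : IsPullback iQ q₀ q (Spec.map (CommRingCat.ofHom ρ)))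
    {U : Q.Opens} (hU : IsAffineOpen (iQ ⁻¹ᵁ U)) : IsAffineOpen U := by
  haveI : IsClosedImmersion iQ :=
    MorphismProperty.of_isPullback hQ.flip (IsClosedImmersion.spec_of_surjective _ hρ)
  exact isAffineOpen_of_isAffineOpen_preimage iQ (isNilpotent_ker_of_isPullback_specMap ρ hρ hnil hQ) hU

/-- **A scheme over `R` whose base change to `R₀ = R/J`, `J` nilpotent, is affine is affine.**
[cite: StacksProject, Tag 06AD] [cite: EGAI, Prop. 5.1.9] -/
theorem isAffine_of_isPullback_specMap (hρ : Function.Surjective ρ)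
    (hnil : IsNilpotent (RingHom.ker ρ)) (hQ : IsPullback iQ q₀ q (Spec.map (CommRingCat.ofHom ρ)))
    [IsAffine Q₀] : IsAffine Q := by
  haveI : IsClosedImmersion iQ :=
    MorphismProperty.of_isPullback hQ.flip (IsClosedImmersion.spec_of_surjective _ hρ)
  exact isAffine_of_isNilpotent_ker iQ (isNilpotent_ker_of_isPullback_specMap ρ hρ hnil hQ)

end SpecBase

end Literature.AlgebraicGeometry.Morphisms

end
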